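import Summits.CriticalPhenomena.PercolationContinuityZ3.Theorems.Transplant.BoxProdZ2SeedGeom
import HarnessLib

/-!
# Seed geometry with DEEP RETRACTION: the fibre set of a thick seed whose cube centre is retracted `Lr + 1` steps into the window while the
# cube keeps fibre radius `nF ≤ Lr` (RETRACTION.md §B: every macro contact of a tube level becomes deep; BLUEPRINT-I-PHI §1 "cube behind a contact")

builds on p205010 (kernel theorem, internal audit signed; external expert review pending) — nothing in this file uses p205010.
Lane `prim-bschramm`, seat `prim-bschramm-p3`; helper file (`--supports stmt-CriticalPhenomena-4575 --as helper`).  Generalises `BoxProdZ2SeedGeom.fibSet`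
(the case `Lr = nF`).

* `fibSetD hw Lr nF` — the last `≤ Lr + 1` vertices of the chosen walk from `xe` to `w` (from `c = fibCtr hw Lr` to `w`) together with the ball
  `B_X(c, nF)`;
* membership of `w`, `c`, `B_X(c, nF)`; `fibSetD ⊆ B_X(xe, R)` (`nF ≤ Lr ≤ R`); localisation `fibSetD ⊆ B_X(w, Lr + nF + 1)`; connectedness from `w`
  (`pathIn_fibSetD`); size `≤ Lr + 2 + (Δ+1)^{nF}`; and **`graphBall_fibCtr_subset_window'`**: `B_X(c, n) ⊆ B_X(xe, R)` for every `n ≤ Lr ≤ R`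
  (the deep route of scale `ℓ` with `ψ ℓ ≤ Lr` fits in the window).

[cite: KozmaNitzan2024, §4 p. 19 (seeds), p. 21 (v(P)) — the ℤ^d model]
-/

noncomputable section

namespace Summit.CriticalPhenomena.PercolationContinuityZ3.Theorems

namespace Transplant

namespace BoxProdZ2

open Literature.Probability.Percolation Literature.Probability.LatticeModels SimpleGraph
open Literature.Barriers.CriticalPhenomena (graphBall graphBall_finite mem_graphBall_self graphBall_mono)

variable {W : Type*} (X : SimpleGraph W) [X.LocallyFinite]

/-- **The fibre set with deep retraction**: the last `≤ Lr + 1` steps of the chosen walk (from `c(w) = fibCtr hw Lr` to `w`) together with the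
ball `B_X(c(w), nF)`. [cite: KozmaNitzan2024, §4 p. 19 (seeds)] -/
def fibSetD [DecidableEq W] {xe w : W} {R : ℕ} (hw : w ∈ graphBall X xe R) (Lr nF : ℕ) : Finset W :=
  ((winWalk X hw).drop ((winWalk X hw).length - (Lr + 1))).support.toFinset ∪ ballFin X (fibCtr X hw Lr) nF

omit [X.LocallyFinite] in
/-- **Balls around the retracted centre fit in the window**: `B_X(c(w), n) ⊆ B_X(xe, R)` for `n ≤ Lr ≤ R`. [folklore] -/
theorem graphBall_fibCtr_subset_window' {xe w : W} {R : ℕ} (hw : w ∈ graphBall X xe R) {Lr n : ℕ} (hn : n ≤ Lr) (hLr : Lr ≤ R) :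
    graphBall X (fibCtr X hw Lr) n ⊆ graphBall X xe R :=
  (graphBall_mono X _ hn).trans (graphBall_fibCtr_subset_window X hw hLr)

/-- `w` itself lies in its fibre set. [folklore] -/
theorem self_mem_fibSetD [DecidableEq W] {xe w : W} {R : ℕ} (hw : w ∈ graphBall X xe R) (Lr nF : ℕ) : w ∈ fibSetD X hw Lr nF :=
  Finset.mem_union_left _ (List.mem_toFinset.2 (Walk.end_mem_support _))

/-- The retracted centre lies in the fibre set. [folklore] -/
theorem fibCtr_mem_fibSetD [DecidableEq W] {xe w : W} {R : ℕ} (hw : w ∈ graphBall X xe R) (Lr nF : ℕ) :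
    fibCtr X hw Lr ∈ fibSetD X hw Lr nF :=
  Finset.mem_union_left _ (List.mem_toFinset.2 (Walk.start_mem_support _))

/-- The cube's fibre ball lies in the fibre set. [folklore] -/
theorem ballFin_fibCtr_subset_fibSetD [DecidableEq W] {xe w : W} {R : ℕ} (hw : w ∈ graphBall X xe R) (Lr nF : ℕ) :
    ballFin X (fibCtr X hw Lr) nF ⊆ fibSetD X hw Lr nF :=
  Finset.subset_union_right

/-- **The fibre set lies in the window** `B_X(xe, R)` (`nF ≤ Lr ≤ R`). [folklore] -/
theorem fibSetD_subset_window [DecidableEq W] {xe w : W} {R : ℕ} (hw : w ∈ graphBall X xe R) {Lr nF : ℕ} (hnF : nF ≤ Lr) (hLr : Lr ≤ R) :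
    fibSetD X hw Lr nF ⊆ ballFin X xe R := by
  intro b hb
  rw [mem_ballFin]
  rcases Finset.mem_union.1 hb with hb | hb
  · rw [List.mem_toFinset, Walk.mem_support_iff_exists_getVert] at hb
    obtain ⟨i, rfl, hi⟩ := hb
    rw [Walk.drop_getVert]
    exact graphBall_mono X xe (by have := winWalk_length X hw; rw [Walk.drop_length] at hi; omega)
      (getVert_mem_graphBall X (winWalk X hw) _)
  · exact graphBall_fibCtr_subset_window' X hw hnF hLr ((mem_ballFin X).1 hb)

/-- **Localisation**: the fibre set lies in `B_X(w, Lr + nF + 1)`. [folklore] -/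
theorem fibSetD_subset_ballFin_self [DecidableEq W] {xe w : W} {R : ℕ} (hw : w ∈ graphBall X xe R) (Lr nF : ℕ) :
    fibSetD X hw Lr nF ⊆ ballFin X w (Lr + nF + 1) := by
  intro b hb
  rw [mem_ballFin]
  rcases Finset.mem_union.1 hb with hb | hb
  · rw [List.mem_toFinset, Walk.mem_support_iff_exists_getVert] at hb
    obtain ⟨i, rfl, hi⟩ := hb
    rw [Walk.drop_getVert]
    refine graphBall_mono X w ?_ (getVert_mem_graphBall_end X (winWalk X hw) _)
    omega
  · have h := mem_graphBall_add X (fibCtr_mem_graphBall_self X hw Lr) ((mem_ballFin X).1 hb)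
    exact graphBall_mono X w (by omega) h

/-- **Connectedness of the fibre set from `w`**: every vertex of the fibre set is joined to `w` by a path of `X` inside it. [folklore] -/
theorem pathIn_fibSetD [DecidableEq W] {xe w : W} {R : ℕ} (hw : w ∈ graphBall X xe R) (Lr nF : ℕ) {b : W} (hb : b ∈ fibSetD X hw Lr nF) :
    PathIn X (↑(fibSetD X hw Lr nF) : Set W) w b := by
  set q := (winWalk X hw).drop ((winWalk X hw).length - (Lr + 1)) with hq
  have hsupp : {u | u ∈ q.support} ⊆ (↑(fibSetD X hw Lr nF) : Set W) := fun u hu =>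
    Finset.mem_coe.2 (Finset.mem_union_left _ (List.mem_toFinset.2 hu))
  have hcw : PathIn X (↑(fibSetD X hw Lr nF) : Set W) w (fibCtr X hw Lr) :=
    ((pathIn_support_of_walk X q w q.end_mem_support).mono hsupp).symm
  rcases Finset.mem_union.1 hb with hb' | hb'
  · exact hcw.trans ((pathIn_support_of_walk X q b (List.mem_toFinset.1 hb')).mono hsupp)
  · exact hcw.trans ((pathIn_ballFin_center X (fibCtr X hw Lr) nF ((mem_ballFin X).1 hb')).mono
      (Finset.coe_subset.2 (ballFin_fibCtr_subset_fibSetD X hw Lr nF)))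

/-- **Size of the fibre set**: at most `Lr + 2 + (Δ+1)^{nF}` vertices. [folklore] -/
theorem card_fibSetD_le [DecidableEq W] {Δ : ℕ} (hΔ : ∀ w, X.degree w ≤ Δ) {xe w : W} {R : ℕ} (hw : w ∈ graphBall X xe R) (Lr nF : ℕ) :
    (fibSetD X hw Lr nF).card ≤ Lr + 2 + (Δ + 1) ^ nF := by
  refine (Finset.card_union_le _ _).trans (add_le_add ?_ (card_ballFin_le X hΔ _ nF))
  refine (List.toFinset_card_le _).trans ?_
  rw [Walk.length_support, Walk.drop_length]
  omega

end BoxProdZ2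

end Transplant

end Summit.CriticalPhenomena.PercolationContinuityZ3.Theorems

end
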